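import Literature.MathematicalPhysics.QuantumManyBody.FreeDirichletGap
import Literature.Analysis.Calculus.HardyPrimitive
import HarnessLib

/-!
# Coordinate lines in configuration space and Hardy's inequality at a face of the box

Topic `Literature/MathematicalPhysics/QuantumManyBody`, grouping namespace `BoseGas.BoxFace`, over
the carriers of `BoseEinsteinCondensation.lean` (`Config N = (ℝ³)^N`, `kineticDensity`). Sobolev-space
plumbing for Dirichlet problems in boxes (used by the right-continuity of the Dirichlet ground-state
energy in the box side, `BoseGasEnergyRightContinuity.lean`, and reusable for ground-state existence
by compactness):

* the coordinate line `t ↦ X + (t - X_p) e_p` through `X` in the direction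
  `e_p = Pi.single i (EuclideanSpace.single k 1)` of the real coordinate `p = (i,k)` of `(ℝ³)^N`
  (the direction along which `kineticDensity` differentiates): coordinates, derivative;
* `BoxFace.lintegral_le_of_lines` — **slicing**: an inequality between the integrals of two
  measurable `[0,∞]`-valued functions along every coordinate line of direction `p` integrates to
  the same inequality on `(ℝ³)^N` (flatten `(ℝ³)^N ≅ ℝ^{N×3}` by the measure-preserving
  `volume_preserving_configFlatten` of `FreeDirichletGap.lean` and peel the coordinate `p` off the
  product integral with Mathlib's marginal integrals `lmarginal`; Tonelli);
* `BoxFace.lintegral_sq_div_sq_le_right` / `_left` — **Hardy's inequality at a face**: for a `C¹`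
  function `Φ` on `(ℝ³)^N` with values in a Banach space, vanishing where `X_p ≥ b`
  (resp. `X_p ≤ b`), `∫_{b-ℓ<X_p<b} ‖Φ‖²/(b - X_p)² ≤ 4 ∫_{b-ℓ<X_p<b} ‖∂_pΦ‖²` (the tree's
  one-dimensional Hardy inequality `lintegral_enorm_sq_intervalIntegral_div_sq_le_right` of
  `Analysis/Calculus/HardyPrimitive.lean` — Hardy–Littlewood–Pólya Thm. 327 — on every line, with
  `Φ(…,t,…) = -∫_t^b ∂_pΦ`, then slicing).

Design: no definitions (the flattening equivalence and the lines are written out, as in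
`FreeDirichletGap.lean`); `[0,∞]`-valued integrals throughout, so no integrability side conditions.
Not here: traces, `H¹` spaces, the Poincaré variant (see `BoseGasWallCutoff.lintegral_wall_le`).

## References

* G. H. Hardy, J. E. Littlewood, G. Pólya, *Inequalities*, 2nd ed. (1952), Thm. 327.
  [HardyLittlewoodPolya1952]
* L. C. Evans, *Partial Differential Equations*, 2nd ed. (2010), §5.7 (the compactness set-up these
  lemmas serve).
-/

noncomputable section

namespace Literature.MathematicalPhysics.QuantumManyBody.BoseGas

open _root_.MeasureTheory _root_.Filter _root_.Set
open scoped ENNReal NNReal Topology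

namespace BoxFace

variable {N : ℕ}

/-! ### Coordinate vectors and coordinate lines -/

/-- Coordinates of the coordinate vector `e_p = Pi.single i (EuclideanSpace.single k 1)`,
`p = (i, k)`. [folklore] -/
theorem coordVec_apply (p : Fin N × Fin 3) (j : Fin N) (m : Fin 3) :
    (Pi.single p.1 (EuclideanSpace.single p.2 (1 : ℝ)) : Config N) j m =
      if j = p.1 ∧ m = p.2 then 1 else 0 := by
  by_cases hj : j = p.1
  · subst hj
    rw [Pi.single_eq_same, EuclideanSpace.single, PiLp.single_apply]
    by_cases hm : m = p.2
    · subst hm; simp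
    · simp [hm]
  · rw [Pi.single_eq_of_ne hj]
    simp [hj]

/-- Coordinates of a point `X + (t - X_p) e_p` of the coordinate line through `X` in direction
`p`, parametrised by the value `t` of the coordinate. [folklore] -/
theorem lineAt_apply (p : Fin N × Fin 3) (X : Config N) (t : ℝ) (j : Fin N) (m : Fin 3) :
    (X + (t - X p.1 p.2) • (Pi.single p.1 (EuclideanSpace.single p.2 (1 : ℝ)) : Config N)) j m =
      if j = p.1 ∧ m = p.2 then t else X j m := by
  simp only [Pi.add_apply, Pi.smul_apply, PiLp.add_apply, PiLp.smul_apply, smul_eq_mul,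
    coordVec_apply]
  split_ifs with h
  · obtain ⟨rfl, rfl⟩ := h; ring
  · ring

/-- The moving coordinate of the line is the parameter. [folklore] -/
@[simp] theorem lineAt_apply_same (p : Fin N × Fin 3) (X : Config N) (t : ℝ) :
    (X + (t - X p.1 p.2) • (Pi.single p.1 (EuclideanSpace.single p.2 (1 : ℝ)) : Config N)) p.1 p.2 =
      t := by
  rw [lineAt_apply, if_pos ⟨rfl, rfl⟩]

/-- The line is an affine map of the parameter with derivative `e_p`. [folklore] -/
theorem hasDerivAt_lineAt (p : Fin N × Fin 3) (X : Config N) (t : ℝ) :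
    HasDerivAt (fun s : ℝ => X + (s - X p.1 p.2) •
        (Pi.single p.1 (EuclideanSpace.single p.2 (1 : ℝ)) : Config N))
      (Pi.single p.1 (EuclideanSpace.single p.2 (1 : ℝ))) t := by
  have h : HasDerivAt (fun s : ℝ => (s - X p.1 p.2) •
      (Pi.single p.1 (EuclideanSpace.single p.2 (1 : ℝ)) : Config N))
      ((1 : ℝ) • (Pi.single p.1 (EuclideanSpace.single p.2 (1 : ℝ)) : Config N)) t :=
    ((hasDerivAt_id t).sub_const _).smul_const _
  rw [one_smul] at h
  exact h.const_add X

/-! ### Flattening and slicing -/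

/-- For the flattening `(ℝ³)^N ≃ᵐ ℝ^{N×3}`, `X ↦ ((i,k) ↦ X_{ik})` (measure preserving:
`volume_preserving_configFlatten`), updating the flat coordinate `p` is moving along the line of
direction `p`. [folklore] -/
theorem configFlatten_symm_update (y : Fin N × Fin 3 → ℝ) (p : Fin N × Fin 3) (t : ℝ) :
    ((MeasurableEquiv.piCongrRight fun _ : Fin N =>
        (MeasurableEquiv.toLp 2 (Fin 3 → ℝ)).symm).trans
          (MeasurableEquiv.curry (Fin N) (Fin 3) ℝ).symm).symm (Function.update y p t) =
      ((MeasurableEquiv.piCongrRight fun _ : Fin N =>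
        (MeasurableEquiv.toLp 2 (Fin 3 → ℝ)).symm).trans
          (MeasurableEquiv.curry (Fin N) (Fin 3) ℝ).symm).symm y +
        (t - ((MeasurableEquiv.piCongrRight fun _ : Fin N =>
          (MeasurableEquiv.toLp 2 (Fin 3 → ℝ)).symm).trans
            (MeasurableEquiv.curry (Fin N) (Fin 3) ℝ).symm).symm y p.1 p.2) •
          (Pi.single p.1 (EuclideanSpace.single p.2 (1 : ℝ)) : Config N) := by
  ext j m
  rw [lineAt_apply]
  change Function.update y p t (j, m) = if j = p.1 ∧ m = p.2 then t else y (j, m)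
  by_cases h : j = p.1 ∧ m = p.2
  · rw [if_pos h]
    obtain ⟨rfl, rfl⟩ := h
    exact Function.update_self _ _ _
  · rw [if_neg h, Function.update_of_ne]
    rintro rfl
    exact h ⟨rfl, rfl⟩

/-- **Slicing along coordinate lines.** If two measurable `[0,∞]`-valued functions on `(ℝ³)^N`
satisfy `∫ F ≤ ∫ G` along every coordinate line of direction `p`, then `∫ F ≤ ∫ G`
(Fubini–Tonelli through the flattening and Mathlib's marginal integrals). [folklore] -/
theorem lintegral_le_of_lines {F G : Config N → ℝ≥0∞} (hF : Measurable F) (hG : Measurable G)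
    (p : Fin N × Fin 3) (h : ∀ X : Config N,
      ∫⁻ t, F (X + (t - X p.1 p.2) • (Pi.single p.1 (EuclideanSpace.single p.2 (1 : ℝ)) : Config N)) ≤
        ∫⁻ t, G (X + (t - X p.1 p.2) • (Pi.single p.1 (EuclideanSpace.single p.2 (1 : ℝ)) : Config N))) :
    ∫⁻ X, F X ≤ ∫⁻ X, G X := by
  set e : Config N ≃ᵐ (Fin N × Fin 3 → ℝ) := (MeasurableEquiv.piCongrRight fun _ : Fin N =>
      (MeasurableEquiv.toLp 2 (Fin 3 → ℝ)).symm).trans (MeasurableEquiv.curry (Fin N) (Fin 3) ℝ).symm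
    with he_def
  have he : MeasurePreserving e.symm volume volume := (volume_preserving_configFlatten N).symm e
  have hemb := e.symm.measurableEmbedding
  rw [← he.lintegral_comp_emb hemb F, ← he.lintegral_comp_emb hemb G]
  have hFm : Measurable (F ∘ e.symm) := hF.comp e.symm.measurable
  have hGm : Measurable (G ∘ e.symm) := hG.comp e.symm.measurable
  change ∫⁻ y, (F ∘ e.symm) y ∂(volume : Measure (Fin N × Fin 3 → ℝ)) ≤
    ∫⁻ y, (G ∘ e.symm) y ∂(volume : Measure (Fin N × Fin 3 → ℝ))
  rw [volume_pi, lintegral_eq_lmarginal_univ (0 : Fin N × Fin 3 → ℝ),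
    lintegral_eq_lmarginal_univ (0 : Fin N × Fin 3 → ℝ),
    lmarginal_erase' _ hFm (Finset.mem_univ p), lmarginal_erase' _ hGm (Finset.mem_univ p)]
  refine lmarginal_mono (fun y => ?_) _
  simp only [Function.comp_apply, he_def, configFlatten_symm_update]
  exact h _

/-! ### Hardy's inequality at a face -/

section Hardy

variable {E : Type*} [NormedAddCommGroup E] [NormedSpace ℝ E]

/-- The slab `{a < X_p < b}` is measurable. [folklore] -/
theorem measurableSet_slab (p : Fin N × Fin 3) (a b : ℝ) :
    MeasurableSet {X : Config N | X p.1 p.2 ∈ Ioo a b} :=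
  measurableSet_Ioo.preimage (by fun_prop)

/-- Restriction of a `C¹` function to a coordinate line: derivative `∂_pΦ`. [folklore] -/
theorem hasDerivAt_comp_lineAt {Φ : Config N → E} (hΦ : ContDiff ℝ 1 Φ) (p : Fin N × Fin 3)
    (X : Config N) (t : ℝ) :
    HasDerivAt (fun s => Φ (X + (s - X p.1 p.2) •
        (Pi.single p.1 (EuclideanSpace.single p.2 (1 : ℝ)) : Config N)))
      (fderiv ℝ Φ (X + (t - X p.1 p.2) • (Pi.single p.1 (EuclideanSpace.single p.2 (1 : ℝ)) : Config N))
        (Pi.single p.1 (EuclideanSpace.single p.2 (1 : ℝ)))) t :=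
  ((hΦ.differentiable one_ne_zero _).hasFDerivAt.comp_hasDerivAt t (hasDerivAt_lineAt p X t))

/-- Along a coordinate line, the indicator of a slab is the indicator of the interval. [folklore] -/
theorem indicator_slab_lineAt (p : Fin N × Fin 3) (a b : ℝ) (H : Config N → ℝ≥0∞) (X : Config N)
    (s : ℝ) :
    ({Y : Config N | Y p.1 p.2 ∈ Ioo a b}).indicator H
        (X + (s - X p.1 p.2) • (Pi.single p.1 (EuclideanSpace.single p.2 (1 : ℝ)) : Config N)) =
      (Ioo a b).indicator (fun s => H (X + (s - X p.1 p.2) •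
        (Pi.single p.1 (EuclideanSpace.single p.2 (1 : ℝ)) : Config N))) s := by
  by_cases hs : s ∈ Ioo a b
  · rw [indicator_of_mem hs, indicator_of_mem]
    simpa only [mem_setOf_eq, lineAt_apply_same] using hs
  · rw [indicator_of_notMem hs, indicator_of_notMem]
    simpa only [mem_setOf_eq, lineAt_apply_same] using hs

/-- **Hardy's inequality at a right face.** For `Φ : (ℝ³)^N → E` of class `C¹` vanishing
wherever `X_p ≥ b`, and every `ℓ`,
`∫_{b-ℓ<X_p<b} ‖Φ X‖² / (b - X_p)² dX ≤ 4 ∫_{b-ℓ<X_p<b} ‖∂_pΦ X‖² dX` (`[0,∞]`-valued; the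
one-dimensional inequality of Hardy–Littlewood–Pólya, Thm. 327, on every coordinate line, using
`Φ(…, t, …) = -∫_t^b ∂_pΦ`). [cite: HardyLittlewoodPolya1952, Thm. 327] -/
theorem lintegral_sq_div_sq_le_right [CompleteSpace E] {Φ : Config N → E} (hΦ : ContDiff ℝ 1 Φ)
    (p : Fin N × Fin 3) {b : ℝ} (h0 : ∀ X, b ≤ X p.1 p.2 → Φ X = 0) (ℓ : ℝ) :
    ∫⁻ X in {X : Config N | X p.1 p.2 ∈ Ioo (b - ℓ) b},
        ‖Φ X‖ₑ ^ 2 / ENNReal.ofReal ((b - X p.1 p.2) ^ 2) ≤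
      4 * ∫⁻ X in {X : Config N | X p.1 p.2 ∈ Ioo (b - ℓ) b},
        ‖fderiv ℝ Φ X (Pi.single p.1 (EuclideanSpace.single p.2 (1 : ℝ)))‖ₑ ^ 2 := by
  have hS := measurableSet_slab (N := N) p (b - ℓ) b
  have hΦc : Continuous Φ := hΦ.continuous
  have hdc : Continuous fun X => fderiv ℝ Φ X (Pi.single p.1 (EuclideanSpace.single p.2 (1 : ℝ))) :=
    (hΦ.continuous_fderiv one_ne_zero).clm_apply continuous_const
  have hcoord : Measurable fun X : Config N => X p.1 p.2 := by fun_prop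
  have hFm : Measurable fun X : Config N => ‖Φ X‖ₑ ^ 2 / ENNReal.ofReal ((b - X p.1 p.2) ^ 2) :=
    ((Continuous.enorm hΦc).measurable.pow_const 2).div (ENNReal.measurable_ofReal.comp
      ((measurable_const.sub hcoord).pow_const 2))
  have hGm : Measurable fun X : Config N =>
      4 * ‖fderiv ℝ Φ X (Pi.single p.1 (EuclideanSpace.single p.2 (1 : ℝ)))‖ₑ ^ 2 :=
    measurable_const.mul ((Continuous.enorm hdc).measurable.pow_const 2)
  rw [← lintegral_const_mul' _ _ (by norm_num), ← lintegral_indicator hS, ← lintegral_indicator hS]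
  refine lintegral_le_of_lines (hFm.indicator hS) (hGm.indicator hS) p fun X => ?_
  simp_rw [indicator_slab_lineAt]
  rw [lintegral_indicator measurableSet_Ioo, lintegral_indicator measurableSet_Ioo]
  -- on the line through `X`: `u(s) = Φ(line s)`, `u' = ∂_pΦ(line s)`, `u b = 0`
  have hud := hasDerivAt_comp_lineAt hΦ p X
  have hu'c : Continuous fun s : ℝ => fderiv ℝ Φ (X + (s - X p.1 p.2) •
      (Pi.single p.1 (EuclideanSpace.single p.2 (1 : ℝ)) : Config N))
        (Pi.single p.1 (EuclideanSpace.single p.2 (1 : ℝ))) :=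
    hdc.comp (continuous_const.add ((continuous_id.sub continuous_const).smul continuous_const))
  have hub : Φ (X + (b - X p.1 p.2) •
      (Pi.single p.1 (EuclideanSpace.single p.2 (1 : ℝ)) : Config N)) = 0 :=
    h0 _ (by rw [lineAt_apply_same])
  have hH := Literature.Analysis.Calculus.lintegral_enorm_sq_intervalIntegral_div_sq_le_right
    (b := b) (ℓ := ℓ) hu'c.aestronglyMeasurable
  refine le_trans (le_of_eq ?_) (hH.trans_eq (lintegral_const_mul' (4 : ℝ≥0∞) _ (by norm_num)).symm)
  refine setLIntegral_congr_fun measurableSet_Ioo fun s _ => ?_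
  simp only [lineAt_apply_same]
  rw [intervalIntegral.integral_eq_sub_of_hasDerivAt (fun r _ => hud r)
    (hu'c.intervalIntegrable _ _), hub, zero_sub, enorm_neg]

/-- **Hardy's inequality at a left face.** For `Φ : (ℝ³)^N → E` of class `C¹` vanishing
wherever `X_p ≤ b`, and every `ℓ`,
`∫_{b<X_p<b+ℓ} ‖Φ X‖² / (X_p - b)² dX ≤ 4 ∫_{b<X_p<b+ℓ} ‖∂_pΦ X‖² dX`. [cite: HardyLittlewoodPolya1952, Thm. 327] -/
theorem lintegral_sq_div_sq_le_left [CompleteSpace E] {Φ : Config N → E} (hΦ : ContDiff ℝ 1 Φ)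
    (p : Fin N × Fin 3) {b : ℝ} (h0 : ∀ X, X p.1 p.2 ≤ b → Φ X = 0) (ℓ : ℝ) :
    ∫⁻ X in {X : Config N | X p.1 p.2 ∈ Ioo b (b + ℓ)},
        ‖Φ X‖ₑ ^ 2 / ENNReal.ofReal ((X p.1 p.2 - b) ^ 2) ≤
      4 * ∫⁻ X in {X : Config N | X p.1 p.2 ∈ Ioo b (b + ℓ)},
        ‖fderiv ℝ Φ X (Pi.single p.1 (EuclideanSpace.single p.2 (1 : ℝ)))‖ₑ ^ 2 := by
  have hS := measurableSet_slab (N := N) p b (b + ℓ)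
  have hΦc : Continuous Φ := hΦ.continuous
  have hdc : Continuous fun X => fderiv ℝ Φ X (Pi.single p.1 (EuclideanSpace.single p.2 (1 : ℝ))) :=
    (hΦ.continuous_fderiv one_ne_zero).clm_apply continuous_const
  have hcoord : Measurable fun X : Config N => X p.1 p.2 := by fun_prop
  have hFm : Measurable fun X : Config N => ‖Φ X‖ₑ ^ 2 / ENNReal.ofReal ((X p.1 p.2 - b) ^ 2) :=
    ((Continuous.enorm hΦc).measurable.pow_const 2).div (ENNReal.measurable_ofReal.comp
      ((hcoord.sub measurable_const).pow_const 2))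
  have hGm : Measurable fun X : Config N =>
      4 * ‖fderiv ℝ Φ X (Pi.single p.1 (EuclideanSpace.single p.2 (1 : ℝ)))‖ₑ ^ 2 :=
    measurable_const.mul ((Continuous.enorm hdc).measurable.pow_const 2)
  rw [← lintegral_const_mul' _ _ (by norm_num), ← lintegral_indicator hS, ← lintegral_indicator hS]
  refine lintegral_le_of_lines (hFm.indicator hS) (hGm.indicator hS) p fun X => ?_
  simp_rw [indicator_slab_lineAt]
  rw [lintegral_indicator measurableSet_Ioo, lintegral_indicator measurableSet_Ioo]
  have hud := hasDerivAt_comp_lineAt hΦ p X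
  have hu'c : Continuous fun s : ℝ => fderiv ℝ Φ (X + (s - X p.1 p.2) •
      (Pi.single p.1 (EuclideanSpace.single p.2 (1 : ℝ)) : Config N))
        (Pi.single p.1 (EuclideanSpace.single p.2 (1 : ℝ))) :=
    hdc.comp (continuous_const.add ((continuous_id.sub continuous_const).smul continuous_const))
  have hub : Φ (X + (b - X p.1 p.2) •
      (Pi.single p.1 (EuclideanSpace.single p.2 (1 : ℝ)) : Config N)) = 0 :=
    h0 _ (by rw [lineAt_apply_same])
  have hH := Literature.Analysis.Calculus.lintegral_enorm_sq_intervalIntegral_div_sq_le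
    (b := b) (ℓ := ℓ) hu'c.aestronglyMeasurable
  refine le_trans (le_of_eq ?_) (hH.trans_eq (lintegral_const_mul' (4 : ℝ≥0∞) _ (by norm_num)).symm)
  refine setLIntegral_congr_fun measurableSet_Ioo fun s _ => ?_
  simp only [lineAt_apply_same]
  rw [intervalIntegral.integral_eq_sub_of_hasDerivAt (fun r _ => hud r)
    (hu'c.intervalIntegrable _ _), hub, sub_zero]

end Hardy

end BoxFace

end Literature.MathematicalPhysics.QuantumManyBody.BoseGas

end
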